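import Summits.NavierStokesRegularity.NavierStokesRegularity.Theorems.GaldiLiouvilleGateCylinderBudgetsRungSplit
import Summits.NavierStokesRegularity.NavierStokesRegularity.Theorems.GaldiLiouvilleGateAllAxesCylinderBookkeeping

/-!
# «Cylinder budgets» lines of `GaldiLiouvilleGate.GaldiLiouville` / `.AxisymGaldiLiouville` — the rungs modulo facts

Sequel of `…CylinderBudgetsRungSplit`: plugs the last support O1c′ `cylinderBookkeepingSplit_holds :
CylinderBookkeepingSplit` (ns-in-ser-a, `…AllAxesCylinderBookkeeping`: the three cut-off limits on the
one-stroke core inequality `core_axialEnergy_bound`), records O1 `CylinderBookkeeping` by name, and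
states the two RUNGS as theorems conditional on EXACTLY the two named Literature facts
`wang2025_lem35_DSolution_pressureHessian_integrable` (W. Wang 2025, Lemma 3.5 = Korobkov–
Pileckas–Russo 2015) and `wang2025_thm21_DSolution_uniformDecay` (W. Wang 2025, Thm 2.1 = Galdi 2011,
Thm X.5.1):

* ⟨0895⟩ rung `hoopEnergyLiouville_modulo_facts : h35 → h21 → HoopEnergyLiouville` — a smooth
  D-solution of steady Navier–Stokes on `ℝ³` (finite Dirichlet integral, `U → 0` at infinity) whose
  azimuthal component about the `x₃`-axis is square-integrable is trivial;
* ⟨0896⟩ rung `finiteSwirlEnergyLiouville_modulo_facts : h35 → h21 → FiniteSwirlEnergyLiouville`.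

Nothing here proves `GaldiLiouville`, `AxisymGaldiLiouville` or any Navier–Stokes regularity statement:
the route decls additionally need the cruxes `HoopTailFinite`/`HoopTailCritical` resp.
`SwirlMomentGain`/`SwirlTailCritical` (`GaldiLiouville_of`, `AxisymGaldiLiouville_of'` in
`…CylinderBudgetsAssembly`).
-/

noncomputable section

open MeasureTheory Filter Set Literature.Analysis.FluidPDE
open scoped ENNReal Topology

-- the problem directory repeats the summit name (D-0017); core's `dupNamespace` linter fires
set_option linter.dupNamespace false

namespace Summit.NavierStokesRegularity.NavierStokesRegularity.Theorems.GaldiLiouville.AllAxesBudget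

/-- O1c of record BY NAME: the cylinder bookkeeping `PressureHessianIntegrable → HeadMaximumPrinciple →
CylinderBudget`, from O1a″ `cylinderDecayOfHessian_holds` (ns-in-wu-p33) and O1c′
`cylinderBookkeepingSplit_holds` (ns-in-ser-a, `…AllAxesCylinderBookkeeping`). -/
theorem cylinderBookkeeping_holds : CylinderBookkeeping :=
  cylinderBookkeeping_of_split cylinderDecayOfHessian_holds cylinderBookkeepingSplit_holds

/-- `CylinderBudget` modulo the two named facts. -/
theorem cylinderBudget_modulo_facts (h35 : wang2025_lem35_DSolution_pressureHessian_integrable)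
    (h21 : wang2025_thm21_DSolution_uniformDecay) : CylinderBudget :=
  cylinderBudget_of_facts h35 h21 cylinderBookkeepingSplit_holds

/-- **RUNG ⟨0895⟩ modulo the two named facts**: `HoopEnergyLiouville` — a smooth D-solution of steady
Navier–Stokes on `ℝ³` whose azimuthal velocity about one axis is square-integrable vanishes
identically — follows from Wang 2025 Lemma 3.5 and Thm 2.1. -/
theorem hoopEnergyLiouville_modulo_facts (h35 : wang2025_lem35_DSolution_pressureHessian_integrable)
    (h21 : wang2025_thm21_DSolution_uniformDecay) : HoopEnergyLiouville :=
  hoopEnergyLiouville_of_facts h35 h21 cylinderBookkeepingSplit_holds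

end Summit.NavierStokesRegularity.NavierStokesRegularity.Theorems.GaldiLiouville.AllAxesBudget

namespace Summit.NavierStokesRegularity.NavierStokesRegularity.Theorems.AxisymGaldiLiouville.CylinderBudget

open Summit.NavierStokesRegularity.NavierStokesRegularity.Theorems.GaldiLiouville

/-- **RUNG ⟨0896⟩ modulo the two named facts**: `FiniteSwirlEnergyLiouville` (axisymmetric
D-solutions with finite swirl energy are trivial) follows from Wang 2025 Lemma 3.5 and Thm 2.1. -/
theorem finiteSwirlEnergyLiouville_modulo_facts
    (h35 : wang2025_lem35_DSolution_pressureHessian_integrable)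
    (h21 : wang2025_thm21_DSolution_uniformDecay) : FiniteSwirlEnergyLiouville :=
  finiteSwirlEnergyLiouville_of_facts h35 h21 AllAxesBudget.cylinderBookkeepingSplit_holds

end Summit.NavierStokesRegularity.NavierStokesRegularity.Theorems.AxisymGaldiLiouville.CylinderBudget

end
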